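import Summits.QuantumFields.BalabanUV.T4Continuum.Support.NE9RemainderSpeciesMargProj
import Summits.QuantumFields.BalabanUV.T4Continuum.Support.NE9RemainderSpeciesCoupling

/-!
# NE9RemainderSpeciesCouplingEnd — leaf A3 for the DISPLAYED species COMPLETED on the v1.3 dictionary: the per-piece coupling
# response of the MARGINAL MULTIPLES (`hrespA`) PRODUCED, and the END-M read-out face at the species with S-sum ∕ S5 ∕ MP ∕ A3
# ALL BY NAME (cell `pub-balaban`, T4-DAG §2 node U3 ∕ §6 NE9; NE9 formalisation swarm, unit `b2b-balaban-t4-ne9-formalise-leaf-09`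
# gen 5, own-initiative micro-item «A3-REM-END», CLAIMS.log l.9334 — the sequel handed over by leaf-03-g4 (l.9163) and
# leaf-04-g5 (l.9312); skeleton `HOME/t4/b2b-balaban-t4-ne9-p1/SKELETON-NE9-P1.md` v1.3.5 rows A3 (R-4) ∕ RO ∕ AW ∕ MP ∕ S5)

HONEST FRAMING (T4-DAG PAGE 1).  Rung (B)+1 of the FINITE-VOLUME T⁴ programme — NOT infinite volume, NOT a mass gap, NOT the
Clay problem.  NE9 (`T4OutputRate.NE9` ∧ `FadingMemory`) is a cell NEW ESTIMATE, NOT PRINTED, NOT discharged here; spine 0/9;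
0/18 skeleton leaves instantiated on Bałaban's objects (O-NE9-1).  HONEST DEPENDENCY (cell line, verbatim): continuum YM on
T⁴ ⇐ BetaPertH ∧ nine spine estimates (0/9 proved); BetaPertH ⇐ (D1) ∧ (D4) ∧ CAP+tail; G-an2-4 gates asym, D1 and NE2/3/4.
`FlowStep.BetaPertH`, (B), (B^μ) do not occur.  [I] = [Balaban1987RG1] (CMP **109**), [II] = [Balaban1988RG2Cluster] (CMP **116**)
are quoted for TYPES only (ABSOLUTE RULE: nothing printed in the audited series is asserted).

WHERE THIS SITS.  Three landed modules meet here: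
* leaf-04-g5's `NE9RemainderSpeciesMargProj` (p213217) — this lineage's END-M read-out face at form level
  (`NE9CPieceCouplingModulus` §4, p212551) APPLIED at the displayed species `P := D.toC` with rows MP ∕ S-sum ∕ S5 DISCHARGED, and
  EXACTLY TWO leaf-A3 binders left displayed: the per-piece coupling responses `hrespE` (of the terms) and `hrespA` (of the
  scale-wise multiples `U X ↦ c(scale X)·A U X` of the marginal direction);
* leaf-03-g4's `NE9RemainderSpeciesCoupling.cpieceResponse_rem` (p213083) — the PRODUCER of `hrespE` from analyticity + the
  (1.18)-type size `TermSize` + three displayed direction binders (d1) contour-continuity, (d2) relative coupling-Lipschitz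
  modulus (TYPE: [II] (1.21) p. 7 — 𝐇_k(s(Y₀), B′) is built on G_k(g_k), [I] (2.12) p. 268), (d3) `c_dir·ℓ < 1∕2`;
* this lineage's `NE9CPieceCouplingModulus` (p212551) — the `hrespA` SHAPE with the factor `|c(scale x)|` in front.
THIS FILE: §1 **`cpieceResponseA_rem`** PRODUCES `hrespA` for the species: at a source `x` of creation step `scale x` the piece
reads the family on the two copies of `x` only (`pieceLocal_rem`), so the scale-wise multiple may be replaced by the CONSTANT
multiple `c(scale x) • A`, which is analytic (`smul_mem_analyticClass`, MP-REM §1) and of (1.18)-type size `|c(scale x)|·aA`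
(AW `DirSize A κ aA`); `cpieceResponse_rem` at that constant family (as a coupling-independent `Functional`) then gives the bound
with `qcA := 64·cA·aA` and `|c(scale x)|` in front — no homogeneity of the (1.23)-functional is used.  §2
**`termSize_ne9_and_fadingMemory_rem_margProj_cpieceForm_A3`** = MP-REM §3 APPLIED BY NAME with `hrespE := cpieceResponse_rem`
and `hrespA := §1`; the one wrinkle — `cpieceResponse_rem` wants `TermSize E W κ N` as INPUT while the face OUTPUTS it — is met
by deriving `TermSize` FIRST through END-M's own internal route (`termSize_of_recursion_vacSub` ∘ `channelSizeNN_of_perStepNN` ∘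
`channelStepSum_compProj` ∕ `channelSizeAtStepNN_compProj` ∘ `projScaleComm_margProj` ∕ `projSize_margProj`, with MP's
`ProjInto` := `projInto_margProj_analytic` and S-sum ∕ S5 on the marginal-free class from `pieceZero_rem` ∕ `pieceLocal_rem` ∕
`csrcScale_rem` ∕ `pieceBoundOnG_rem` + `pieceBoundOnG_mono`) — one-history binders only, no `TermSize` hypothesis, no
circularity.  AFTER THIS FACE the channel side displays ONLY: O1-type data; the species' `RemData.Admissible` ((I.3.36)–(3.53)
domain inclusion, radii, G1 — TYPE) and `LevelCountsG` ((1.26)–(1.28) numerals); `Adm ⊆ analyticClass` with S1; AW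
(`DirSize A κ aA`, `A ∈ analyticClass`, `hAmul`); RO (`hrA hr0 hrs hcr`, ray-homogeneity `hcoef`, normalisation `hnorm`) and the
S-closure `hS`; (w16)'s additivity `PieceAdditiveOn (analyticClass D.R) D.toC`; A3's direction binders (d1)–(d3) with
`0 ≤ cA`, `0 < c_dir`, `0 < ℓ`; `N j ≤ Nbar`; END-M's A1 ∕ A2 ∕ R ∕ G ∕ N binders VERBATIM.  GONE vs MP-REM §3: `hrespE`,
`hrespA`, `hqc`, `hqcA`, `hℓg`.  NOT PRINTED and not claimed: that Bałaban's (1.23) pieces, 𝐇_k, probes (1.20) or A^η meet these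
binders (O-NE9-1 ∕ O-NE9-5 ∕ (w8) ∕ (w9)).  DISGUISE TEST: every coupling clause compares the SAME family at two coupling
ARGUMENTS `g k`, `g′ k`; sizes are one-history; no joint two-history statement; the END is applied by name — not NE9.

WHAT IS PROVED (kernel, `[folklore]` bookkeeping; 0 sorry, 0 `def`).
§1 `termSize_const_smul` (the (1.18)-type size of a constant multiple of the direction), **`cpieceResponseA_rem`** (= p212551's ∕
   MP-REM's `hrespA` at `P := D.toC`, `Kp := KpOf D c_dir`, `gain := ℓ⁵`, `qcA := 64·cA·aA`, token for token).
§2 **`termSize_ne9_and_fadingMemory_rem_margProj_cpieceForm_A3`**: conclusion LITERALLY MP-REM §3's (= END-M `…_margProj`'s) with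
   `qc := 64·cA·Nbar`, `qcA := 64·cA·aA`, `τbar := c_Q`.

References (TYPES only): [Balaban1987RG1] T. Bałaban, CMP **109** (1987) 249–301, (0.28)–(0.30) p. 258, (1.3) p. 260,
(1.11)–(1.14) p. 262, (1.18) p. 263, (1.20)–(1.22) p. 264, (2.12)–(2.13) p. 268; [Balaban1988RG2Cluster] T. Bałaban, CMP **116**
(1988) 1–22, (1.21)–(1.25) p. 7, (1.26)–(1.29) p. 8, (1.33)–(1.36) p. 9, Lemma 3 (2.38) p. 20.  Summits-side NEW work (LEAN PLACEMENT
RULE); imports `NE9RemainderSpeciesMargProj` (leaf-04-g5) and `NE9RemainderSpeciesCoupling` (leaf-03-g4) BY NAME; modifies nothing;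
0 sorry.  Value = leaf A3 for the displayed species discharged on the dictionary face at FORM level, NOT summit progress.
-/

noncomputable section

namespace Summit.QuantumFields.BalabanUV.T4Continuum.NE9RemainderSpeciesCouplingEnd

open scoped BigOperators
open Metric Set
open Literature.MathematicalPhysics.QuantumFieldTheory.Balaban1983to89
open Literature.MathematicalPhysics.QuantumFieldTheory.Balaban1983to89.T4OutputRate
open Literature.MathematicalPhysics.QuantumFieldTheory.Balaban1983to89.T4HistoryLipschitzRecursion
open Literature.MathematicalPhysics.QuantumFieldTheory.Balaban1983to89.T4HistoryLipschitzOuter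
open Literature.MathematicalPhysics.QuantumFieldTheory.Balaban1983to89.T4HistoryLipschitzActivity
open Literature.MathematicalPhysics.QuantumFieldTheory.Balaban1983to89.T4HistoryLipschitzActivity (ClusterGeom)
open Literature.MathematicalPhysics.QuantumFieldTheory.Balaban1983to89.T4HistoryLipschitzSegment
open Summit.QuantumFields.BalabanUV.T4Continuum.NE9Lemma1Counting
open Summit.QuantumFields.BalabanUV.T4Continuum.NE9Lemma1Gain
open Summit.QuantumFields.BalabanUV.T4Continuum.NE9Lemma1PieceClass
open Summit.QuantumFields.BalabanUV.T4Continuum.NE9Lemma1RemainderSpecies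
open Summit.QuantumFields.BalabanUV.T4Continuum.NE9Lemma1RemainderSpeciesEnd
open Summit.QuantumFields.BalabanUV.T4Continuum.NE9ComplexEncoding (doubleCarriers)
open Summit.QuantumFields.BalabanUV.T4Continuum.NE9LastCouplingBridge
open Summit.QuantumFields.BalabanUV.T4Continuum.NE9BridgeSizeInduction
open Summit.QuantumFields.BalabanUV.T4Continuum.NE9MarginalProjection
open Summit.QuantumFields.BalabanUV.T4Continuum.NE9MarginalProjectionEnd
open Summit.QuantumFields.BalabanUV.T4Continuum.NE9CPieceCouplingModulus
open Summit.QuantumFields.BalabanUV.T4Continuum.NE9RemainderSpeciesMargProj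
open Summit.QuantumFields.BalabanUV.T4Continuum.NE9RemainderSpeciesCoupling (cpieceResponse_rem)

variable {C₀ : Carriers} {E : Type} [NormedAddCommGroup E] [NormedSpace ℂ E] {ι α β γ δ : Type} [DecidableEq δ]

/-! ## §1 The per-piece coupling response of the marginal multiples (`hrespA`) for the displayed species -/

omit [NormedAddCommGroup E] [NormedSpace ℂ E] in
/-- The (1.18)-type size of a CONSTANT real multiple of the marginal direction, as a coupling-independent family: from AW
`DirSize A κ aA` (`|A U X| ≤ aA·e^{−κd(X)}`), `TermSize (fun _ => c • A) W κ (fun _ => |c|·aA)`. [folklore] -/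
theorem termSize_const_smul {W : Set (ℕ → ℝ)} {κ aA : ℝ} {A : E → (doubleCarriers C₀).Dom → ℝ} (hA : DirSize A κ aA)
    (c : ℝ) : TermSize (fun _ : ℕ → ℝ => c • A) W κ (fun _ => |c| * aA) := by
  intro g _ U X
  simp only [Pi.smul_apply, smul_eq_mul]
  rw [abs_mul]
  calc |c| * |A U X| ≤ |c| * (aA * Real.exp (-(κ * (doubleCarriers C₀).d X))) :=
        mul_le_mul_of_nonneg_left (hA U X) (abs_nonneg c)
    _ = Real.exp (-(κ * (doubleCarriers C₀).d X)) * (|c| * aA) := by ring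

/-- **`hrespA` FOR THE DISPLAYED SPECIES (kernel; the producer of MP-REM §3's ∕ p212551 §4's second leaf-A3 binder).**  For an
ANALYTIC marginal direction `A` ([I] (1.11)–(1.14) p. 262: the one-cube Wilson action is analytic in the background — TYPE) of AW
size `DirSize A κ aA`, the species' binders `RemData.Admissible`, and leaf-03-g4's three displayed DIRECTION binders — (d1) the
contour directions are continuous on the contours, (d2) their RELATIVE coupling-Lipschitz modulus `cA·(c_dir·ℓ k j·R_X)·|g k − g′ k|`
on the contours (TYPE [II] (1.21)–(1.22) p. 7, [I] (2.12) p. 268 — asserted for nothing of Bałaban's), (d3) `c_dir·ℓ k j < 1∕2` with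
`0 < c_dir`, `0 < ℓ k j` — the species' piece of EVERY scale-wise multiple `U X ↦ c(scale X)·A U X` responds to the last coupling
by at most `|c(scale x)|·(KpOf D c_dir k y·(64·cA·aA)·(ℓ k j)⁵·e^{−κd(x)}·exp(−⅛(κ₁−1)d_k(Y) + ⅛κ₁d₀ − ½(κ₁−1)·#cubes)·|g k − g′ k|)`.
PROOF: the piece sourced at `x` reads the family on the creation-step slice of `x` only (`pieceLocal_rem`), where the scale-wise
multiple IS the constant multiple `c(scale x) • A`; that family is analytic (`smul_mem_analyticClass`) and of size `|c(scale x)|·aA`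
(`termSize_const_smul`), so `cpieceResponse_rem` at the coupling-independent family `fun _ => c(scale x) • A` applies, and the
constant comes out in front.  No homogeneity of the (1.23)-functional is used.
[cite: Balaban1987RG1, (1.11)-(1.14) p.262, (1.18) p.263, (2.12) p.268; Balaban1988RG2Cluster, (1.21)-(1.25) p.7] -/
theorem cpieceResponseA_rem {D : RemData C₀ E ι α β γ δ} {ℓ : ℕ → ℕ → ℝ} {cdir d0 : ℝ} (hD : D.Admissible ℓ cdir d0)
    {W : Set (ℕ → ℝ)} {κ aA cA : ℝ} {A : E → (doubleCarriers C₀).Dom → ℝ}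
    (hAan : A ∈ analyticClass D.R) (hA : DirSize A κ aA) (haA : 0 ≤ aA)
    (hcA : 0 ≤ cA) (hcdir : 0 < cdir) (hℓ : ∀ k j, 0 < ℓ k j) (hhalf : ∀ k j, cdir * ℓ k j < 1 / 2)
    (hcont : ∀ (k : ℕ) (s : ℕ → ℝ) (y : ι) (a : α) (b : β) (x : (doubleCarriers C₀).Dom),
      ContinuousOn (fun p : ℂ × ((δ → ℝ) × (δ → ℂ)) => D.dir k s y a b x p.1 p.2.1 p.2.2)
        (sphere (0:ℂ) (D.r k) ×ˢ {q | OnContour D.κ₁ (D.cubes k y a b) q.1 q.2}))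
    (hlip : ∀ g ∈ W, ∀ g' ∈ W, ∀ (k : ℕ) (y : ι), ∀ a ∈ D.S0 k y, ∀ b ∈ D.SY k y a, ∀ (j : ℕ), ∀ x ∈ D.src k y a j,
      ∀ t ∈ sphere (0:ℂ) (D.r k), ∀ (s' : δ → ℝ) (σ' : δ → ℂ), OnContour D.κ₁ (D.cubes k y a b) s' σ' →
        ‖D.dir k g y a b x t s' σ' - D.dir k g' y a b x t s' σ'‖ ≤ cA * (cdir * ℓ k j * D.R x.1) * |g k - g' k|) :
    ∀ g ∈ W, ∀ g' ∈ W, ∀ (k : ℕ) (y : ι), ∀ a' ∈ D.toC.S0 k y, ∀ b ∈ D.toC.SY k y a', ∀ (j : ℕ),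
      ∀ x ∈ D.toC.src k y a' j, ∀ c : ℕ → ℝ,
      |D.toC.piece k g y a' b x (fun U X => c ((doubleCarriers C₀).scale X) * A U X) -
          D.toC.piece k g' y a' b x (fun U X => c ((doubleCarriers C₀).scale X) * A U X)| ≤
        |c ((doubleCarriers C₀).scale x)| * (KpOf D cdir k y * (64 * cA * aA) * ℓ k j ^ 5 *
          Real.exp (-(κ * (doubleCarriers C₀).d x)) *
          Real.exp (-(1 / 8) * (D.κ₁ - 1) * D.toC.dY k y + (1 / 8) * D.κ₁ * d0 - (1 / 2) * (D.κ₁ - 1) * D.toC.vol k y a' b) *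
            |g k - g' k|) := by
  intro g hg g' hg' k y a' ha' b hb j x hx c
  -- the constant multiple read on the creation-step slice of the source
  set c₀ : ℝ := c ((doubleCarriers C₀).scale x) with hc₀
  have hloc : ∀ s : ℕ → ℝ,
      D.toC.piece k s y a' b x (fun U X => c ((doubleCarriers C₀).scale X) * A U X) = D.toC.piece k s y a' b x (c₀ • A) := by
    intro s
    refine pieceLocal_rem D k s y a' b x _ _ (fun U X hX => ?_)
    simp only [Pi.smul_apply, smul_eq_mul, hc₀, hX]
  rw [hloc g, hloc g']
  -- analyticity and size of the constant multiple, as a coupling-independent family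
  have hFan : ∀ g₁ ∈ W, (fun _ : ℕ → ℝ => c₀ • A) g₁ ∈ analyticClass D.R := fun _ _ => smul_mem_analyticClass hAan c₀
  have hT : TermSize (fun _ : ℕ → ℝ => c₀ • A) W κ (fun _ => |c₀| * aA) := termSize_const_smul hA c₀
  have hN0 : ∀ _j : ℕ, 0 ≤ |c₀| * aA := fun _ => mul_nonneg (abs_nonneg _) haA
  have key := cpieceResponse_rem hD (Ef := fun _ : ℕ → ℝ => c₀ • A) (Nbar := |c₀| * aA) hFan hT hN0 (fun _ => le_rfl) hcA
    hcdir hℓ hhalf hcont hlip g hg g' hg' k y a' ha' b hb j x hx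
  calc |D.toC.piece k g y a' b x (c₀ • A) - D.toC.piece k g' y a' b x (c₀ • A)|
      ≤ KpOf D cdir k y * (64 * cA * (|c₀| * aA)) * ℓ k j ^ 5 * Real.exp (-(κ * (doubleCarriers C₀).d x)) *
          Real.exp (-(1 / 8) * (D.κ₁ - 1) * D.toC.dY k y + (1 / 8) * D.κ₁ * d0 - (1 / 2) * (D.κ₁ - 1) * D.toC.vol k y a' b) *
            |g k - g' k| := key
    _ = |c₀| * (KpOf D cdir k y * (64 * cA * aA) * ℓ k j ^ 5 * Real.exp (-(κ * (doubleCarriers C₀).d x)) *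
          Real.exp (-(1 / 8) * (D.κ₁ - 1) * D.toC.dY k y + (1 / 8) * D.κ₁ * d0 - (1 / 2) * (D.κ₁ - 1) * D.toC.vol k y a' b) *
            |g k - g' k|) := by ring

/-! ## §2 The END-M read-out face at the displayed species with S-sum ∕ S5 ∕ MP ∕ A3 all by name -/

section EndFace

variable (G : ClusterGeom (doubleCarriers C₀)) {Pot : Type*} [NormedAddCommGroup Pot] [NormedSpace ℂ Pot]

/-- **NE9 ∧ FADING MEMORY ∧ TERM SIZE ON THE v1.3 DICTIONARY AT THE DISPLAYED SPECIES — rows MP, S-sum, S5 AND LEAF A3 DISCHARGED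
(kernel end-to-end).**  leaf-04-g5's `NE9RemainderSpeciesMargProj.termSize_ne9_and_fadingMemory_rem_margProj_cpieceForm` (p213217;
= this lineage's p212551 §4 at `P := D.toC` with MP ∕ S-sum ∕ S5 by name) APPLIED BY NAME with its two displayed leaf-A3 binders
PRODUCED: `hrespE := NE9RemainderSpeciesCoupling.cpieceResponse_rem` (leaf-03-g4, p213083; `qc := 64·cA·Nbar`) and
`hrespA := cpieceResponseA_rem` (§1; `qcA := 64·cA·aA`).  The `TermSize E W κ N` input of `cpieceResponse_rem` is derived FIRST by
END-M's own internal route (`termSize_of_recursion_vacSub` ∘ `channelSizeNN_of_perStepNN` ∘ `channelStepSum_compProj` ∕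
`channelSizeAtStepNN_compProj` ∘ `projScaleComm_margProj` ∕ `projSize_margProj`; MP's `ProjInto` := `projInto_margProj_analytic`;
S-sum ∕ S5 on the marginal-free class `{H | H ∈ analyticClass D.R ∧ H ∈ S ∧ ∀ j, r_j(H↾j) = 0}` from `pieceZero_rem` ∕ `pieceLocal_rem`
∕ `csrcScale_rem` ∕ `pieceBoundOnG_rem` + `pieceBoundOnG_mono`) — one-history binders only; no `TermSize` hypothesis; no circularity.
DISPLAYED (honest list): O1-type data; `RemData.Admissible` ((I.3.36)–(3.53) domain inclusion, radii, G1 — TYPE) and `LevelCountsG`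
((1.26)–(1.28)); `Adm ⊆ analyticClass D.R` and S1 `AdmissibleTerms`; AW (`DirSize A κ aA`, `A ∈ analyticClass D.R`, `hAmul`); RO
(`hrA hr0 hrs hcr`, `hcoef`, `hnorm`) and `hS`; (w16)'s `PieceAdditiveOn (analyticClass D.R) D.toC`; leaf A3's DIRECTION binders
(d1) `hcont`, (d2) `hlip` (constant `cA ≥ 0`), (d3) `hhalf` with `0 < c_dir`, `0 < ℓ k j` (TYPE [II] (1.21)–(1.22) p. 7, [I]
(3.36) p. 277 — asserted for nothing of Bałaban's); `N j ≤ Nbar`; END-M's A1 ∕ A2 ∕ R ∕ G ∕ N binders VERBATIM.  GONE vs MP-REM §3: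
`hrespE`, `hrespA`, `hqc`, `hqcA`, `hℓg`.  Conclusion = MP-REM §3's ∕ END-M `…_margProj`'s with `qc := 64·cA·Nbar`, `qcA := 64·cA·aA`,
`τbar := c_Q`: `qTbar = (64·cA·Nbar + cr·Nbar·(64·cA·aA))·c_Q·(1−ω)⁻¹`.  Nothing of [I]–[II] asserted; NE9 NOT PROVED; 0/9 unchanged.
[cite: Balaban1987RG1, (0.28)-(0.30) p.258, (1.3) p.260, (1.11)-(1.14) p.262, (1.18) p.263, (1.20)-(1.22) p.264, (2.12)-(2.13) p.268; Balaban1988RG2Cluster, (1.21)-(1.29) pp.7-8, (1.33)-(1.36) p.9, Lemma 3 (2.38) p.20] -/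
theorem termSize_ne9_and_fadingMemory_rem_margProj_cpieceForm_A3
    {D : RemData C₀ E ι α β γ δ} {ℓg : ℕ → ℕ → ℝ} {cdir d0 : ℝ}
    {Ef : Functional (doubleCarriers C₀) E} {W : Set (ℕ → ℝ)} {Adm S : Set (E → (doubleCarriers C₀).Dom → ℝ)}
    {r : ℕ → (E → (doubleCarriers C₀).Dom → ℝ) → ℝ} {A : E → (doubleCarriers C₀).Dom → ℝ}
    {Ψ : ℕ → ℝ → (ι → ℝ) → E → (doubleCarriers C₀).Dom → ℝ} {act : ℕ → ℝ → E → Pot → G.P → ℂ} {𝒜 : ℕ → Set Pot}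
    {n : ℕ → ℝ → E → G.P → ℝ} {lip clip : ℕ → ℝ} {a d : G.P → ℝ} {δv : (doubleCarriers C₀).Dom → ℝ}
    {κ O1 cQ ω cA Nbar B lipbar clipbar cr aA : ℝ} {p₀ N : ℕ → ℝ}
    (ρ : ℕ → (ι → ℝ) → Pot) (U₀ : E) (explZ : ℕ → E → (doubleCarriers C₀).Dom → ℝ) (h0 : ScaleZeroFree Ef W)
    (hAdm : AdmissibleTerms Ef W Adm) (hres : AdmRestrict Adm)
    -- the species' binders (printed TYPE + numerals) and the analyticity of the admissible terms
    (hD : D.Admissible ℓg cdir d0)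
    (hL : LevelCountsG D.toC.frame κ D.κ₁ O1 cQ (fun k j => ℓg k j ^ 5) (agePow ω))
    (hAdmAn : Adm ⊆ analyticClass D.R)
    -- crew row (w16): additivity of the (1.23)-pieces in the old term on the analytic class (displayed; produced by
    -- `NE9Lemma1RemainderSpeciesAdditive.pieceAdditiveOn_rem` from its direction-regularity pair)
    (hA16 : PieceAdditiveOn (analyticClass D.R) D.toC)
    -- the read-out and the marginal direction (END-M's RO / AW binders, verbatim) …
    (hrA : ReadAdditive Adm r) (hr0 : ReadZero r) (hrs : ReadSize Adm r κ cr) (hA : DirSize A κ aA) (hcr : 0 ≤ cr)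
    (haA : 0 ≤ aA)
    -- … and what MP needs of them at the species (MP-REM, verbatim)
    (hAan : A ∈ analyticClass D.R)
    (hAmul : ∀ c : ℕ → ℝ, (fun U X' => c ((doubleCarriers C₀).scale X') * A U X') ∈ Adm)
    (hcoef : ∀ (j : ℕ) (c : ℝ), r j (restrictScale j (c • A)) = c * r j (restrictScale j A))
    (hnorm : ∀ j : ℕ, r j (restrictScale j A) = 1 ∨ ∀ H ∈ Adm, r j (restrictScale j H) = 0)
    (hS : ∀ H ∈ Adm, margProj r A H ∈ S)
    -- leaf A3 at the species: the DIRECTION binders (d1)–(d3) of `cpieceResponse_rem` (displayed TYPE) and their scalars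
    (hcA : 0 ≤ cA) (hcdir : 0 < cdir) (hℓpos : ∀ k j, 0 < ℓg k j) (hhalf : ∀ k j, cdir * ℓg k j < 1 / 2)
    (hcont : ∀ (k : ℕ) (s : ℕ → ℝ) (y : ι) (a' : α) (b : β) (x : (doubleCarriers C₀).Dom),
      ContinuousOn (fun p : ℂ × ((δ → ℝ) × (δ → ℂ)) => D.dir k s y a' b x p.1 p.2.1 p.2.2)
        (sphere (0:ℂ) (D.r k) ×ˢ {q | OnContour D.κ₁ (D.cubes k y a' b) q.1 q.2}))
    (hlip : ∀ g ∈ W, ∀ g' ∈ W, ∀ (k : ℕ) (y : ι), ∀ a' ∈ D.S0 k y, ∀ b ∈ D.SY k y a', ∀ (j : ℕ), ∀ x ∈ D.src k y a' j,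
      ∀ t ∈ sphere (0:ℂ) (D.r k), ∀ (s' : δ → ℝ) (σ' : δ → ℂ), OnContour D.κ₁ (D.cubes k y a' b) s' σ' →
        ‖D.dir k g y a' b x t s' σ' - D.dir k g' y a' b x t s' σ'‖ ≤ cA * (cdir * ℓg k j * D.R x.1) * |g k - g' k|)
    (hO1 : 0 ≤ O1) (hcQ : 0 ≤ cQ) (hω0 : 0 ≤ ω) (hω1 : ω < 1) (hNb : ∀ j, N j ≤ Nbar)
    -- END-M's remaining binders at `T := cpieceChannel D.toC ∘ margProj r A`, verbatim
    (hfac : Factorises Ef W (compProj (cpieceChannel D.toC) (margProj r A)) Ψ) (hclip0 : ∀ k, 0 ≤ clip k)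
    (hCup : ∀ g ∈ W, ∀ g' ∈ W, ∀ (k : ℕ) (U : E) (X : (doubleCarriers C₀).Dom), (doubleCarriers C₀).scale X = k + 1 →
      ∀ Q ∈ 𝒜 k, ∀ γ' ∈ G.vol X,
      ‖act k (g k) U Q γ'‖ ≤ n k (g' k) U γ' ∧
        ‖act k (g k) U Q γ' - act k (g' k) U Q γ'‖ ≤ clip k * |g k - g' k| * n k (g' k) U γ')
    (hreprV : ∀ (k : ℕ) (s : ℝ) (Q : ι → ℝ) (U : E) (X : (doubleCarriers C₀).Dom),
      Ψ k s Q U X = (G.newTerm act k s U X (ρ k Q)).re - (G.newTerm act k s U₀ X (ρ k Q)).re + explZ k U X)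
    (hclipb : ∀ k, clip k ≤ clipbar)
    (hK : TwoPointKP G W act 𝒜 n lip a d) (hdec : G.DecayExtract δv d) (hpin : G.PinBudget a δv (fun _ => B) κ)
    (hρ : ∀ (k : ℕ) (Q Q' : ι → ℝ) (M : ℝ),
      (∀ y, |Q y - Q' y| ≤ weightOf D.toC.frame D.κ₁ d0 O1 (KpOf D cdir) k y * M) → ‖ρ k Q - ρ k Q'‖ ≤ M)
    (hexplZ : ∀ (k : ℕ) (U : E) (X : (doubleCarriers C₀).Dom), (doubleCarriers C₀).scale X = k + 1 →
      |explZ k U X| ≤ Real.exp (-(κ * (doubleCarriers C₀).d X)) * p₀ k)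
    (hbase : ∀ g ∈ W, ∀ (U : E) (X : (doubleCarriers C₀).Dom), (doubleCarriers C₀).scale X = 0 →
      |Ef g U X| ≤ Real.exp (-(κ * (doubleCarriers C₀).d X)) * N 0)
    (hNsucc : ∀ j, p₀ j + 2 * B ≤ N (j + 1)) (hNnn : ∀ j, 0 ≤ N j)
    (hbox : ∀ (k : ℕ) (Q : ι → ℝ),
      (∀ y, |Q y| ≤ weightOf D.toC.frame D.κ₁ d0 O1 (KpOf D cdir) k y *
        sizeRadius (fun k j => (1 + cr * aA) * tauOfG cQ (agePow ω) k j) N k) → ρ k Q ∈ 𝒜 k)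
    (hB : 0 ≤ B) (hlipb : ∀ k, lip k ≤ lipbar) (hpos : 0 < ω + 8 * lipbar * B * ((1 + cr * aA) * cQ)) :
    TermSize Ef W κ N ∧
      NE9 Ef W κ (prodModuli (8 * clipbar * B + 8 * lipbar * B *
          ((64 * cA * Nbar + cr * Nbar * (64 * cA * aA)) * cQ * (1 - ω)⁻¹))
        fun _ => ω + 8 * lipbar * B * ((1 + cr * aA) * cQ)) ∧
        FadingMemory ((8 * clipbar * B + 8 * lipbar * B *
              ((64 * cA * Nbar + cr * Nbar * (64 * cA * aA)) * cQ * (1 - ω)⁻¹)) /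
            (ω + 8 * lipbar * B * ((1 + cr * aA) * cQ)))
          (ω + 8 * lipbar * B * ((1 + cr * aA) * cQ))
          (prodModuli (8 * clipbar * B + 8 * lipbar * B *
              ((64 * cA * Nbar + cr * Nbar * (64 * cA * aA)) * cQ * (1 - ω)⁻¹))
            fun _ => ω + 8 * lipbar * B * ((1 + cr * aA) * cQ)) := by
  have hℓg : ∀ k j, 0 ≤ ℓg k j := fun k j => (hℓpos k j).le
  -- MP at the species (MP-REM §2) and the class inclusion
  have hPinto : ProjInto Adm {H | H ∈ analyticClass D.R ∧ H ∈ S ∧ ∀ j, r j (restrictScale j H) = 0} (margProj r A) :=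
    projInto_margProj_analytic hAdmAn hAan hAmul hrA hcoef hnorm hS
  have hMF := margFree_subset_analyticClass (E := E) D.R S r
  -- S-sum / S5 on the marginal-free class from the owner's lemmas for the species
  have hPiece : PieceBoundOnG {H | H ∈ analyticClass D.R ∧ H ∈ S ∧ ∀ j, r j (restrictScale j H) = 0} D.toC κ D.κ₁ d0
      (KpOf D cdir) (fun k j => ℓg k j ^ 5) :=
    pieceBoundOnG_mono hMF (pieceBoundOnG_rem hD hℓg κ)
  have hcQℓ : ∀ k j, 0 ≤ cQ * agePow ω k j := fun k j => mul_nonneg hcQ (agePow_nonneg hω0 k j)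
  have hsum' : ChannelStepSum {H | H ∈ analyticClass D.R ∧ H ∈ S ∧ ∀ j, r j (restrictScale j H) = 0}
      (cpieceChannel D.toC) :=
    channelStepSum_cpiece (pieceZero_rem D) (pieceLocal_rem D) (csrcScale_rem hD) _
  have hstep' : ChannelSizeAtStepNN {H | H ∈ analyticClass D.R ∧ H ∈ S ∧ ∀ j, r j (restrictScale j H) = 0}
      (cpieceChannel D.toC) κ (weightOf D.toC.frame D.κ₁ d0 O1 (KpOf D cdir)) (tauOfG cQ (agePow ω)) :=
    channelSizeAtStepNN_cpieceG (pieceZero_rem D) (pieceLocal_rem D) (csrcScale_rem hD) hPiece hL (kpOf_nonneg hD) hO1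
      (fun k j => pow_nonneg (hℓg k j) 5) hcQℓ
  -- the size profile FIRST (END-M's own internal route; one-history binders only)
  have hPcomm : ProjScaleComm Adm (margProj r A) := projScaleComm_margProj Adm A hr0
  have hPsize : ProjSize Adm (margProj r A) κ (cr * aA) := projSize_margProj hrs hA hcr
  have hc : 0 ≤ cr * aA := mul_nonneg hcr haA
  have hT : TermSize Ef W κ N :=
    (termSize_of_recursion_vacSub G ρ U₀ explZ hAdm
      (channelSizeNN_of_perStepNN hres (channelStepSum_compProj hPcomm hPinto hsum')
        (channelSizeAtStepNN_compProj hPcomm hPinto hPsize hc hstep'))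
      hfac hK hdec hpin hreprV hexplZ hbase hNsucc hNnn hbox).1
  -- leaf A3 PRODUCED: the terms (leaf-03-g4) and the marginal multiples (§1)
  have hE : ∀ g ∈ W, Ef g ∈ analyticClass D.R := fun g hg => hAdmAn (hAdm.1 g hg)
  have hrespE := cpieceResponse_rem hD hE hT hNnn hNb hcA hcdir hℓpos hhalf hcont hlip
  have hrespA := cpieceResponseA_rem hD (W := W) hAan hA haA hcA hcdir hℓpos hhalf hcont hlip
  have hNbar : 0 ≤ Nbar := (hNnn 0).trans (hNb 0)
  have hqc : 0 ≤ 64 * cA * Nbar := by positivity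
  have hqcA : 0 ≤ 64 * cA * aA := by positivity
  exact termSize_ne9_and_fadingMemory_rem_margProj_cpieceForm G ρ U₀ explZ h0 hAdm hres hD hℓg hL hAdmAn hA16 hrA hr0 hrs hA
    hcr haA hAan hAmul hcoef hnorm hS hrespE hrespA hqc hqcA hO1 hcQ hω0 hω1 hNb hfac hclip0 hCup hreprV hclipb hK hdec hpin
    hρ hexplZ hbase hNsucc hNnn hbox hB hlipb hpos

end EndFace

end Summit.QuantumFields.BalabanUV.T4Continuum.NE9RemainderSpeciesCouplingEnd

end
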